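import Literature.NumberTheory.QuadraticFields.IdealClassEpsteinSum
import Literature.NumberTheory.QuadraticFields.FormIdealsStructure
import HarnessLib

/-!
# Quadratic fields — the ideals of prime-power norm

Topic `NumberTheory/QuadraticFields`; proof companion of `FormIdealsStructure.lean` (every non-zero
ideal of a quadratic ring `ℤ ⊕ ℤω`, `ω² = m + tω`, is `(g)(A, ω − k)` with `AC = k² − tk − m`) and
`IdealClassEpsteinSum.lean` (`N(A, ω − k) = A`). Everything here is PROVED; no definition, no
named fact.

For a rational prime `p` and the ring of integers `𝓞 K = ℤ ⊕ ℤω` of a quadratic field, the local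
structure behind the enumeration of the ideals of a given norm (Cox, *Primes of the form x² + ny²*,
§5.B Prop. 5.16 / §7.B; Cohen, *A Course in Computational Algebraic Number Theory*, §5.2):

* `exists_eq_span_pair_of_absNorm_eq_prime` — an ideal of norm `p` is `(p, ω − k)` with
  `p ∣ N(ω − k) = k² − tk − m` (Hermite normal form with `g²A = p`);
* `span_pair_mul_span_pair_conj` — for a primitive `(A, ω − k)` (`gcd(A, 2k − t, C) = 1`,
  `AC = k² − tk − m`), `(A, ω − k)(A, ω − (t − k)) = (A)`: an ideal times its conjugate is its norm;
* `eq_or_eq_of_isPrime_of_natCast_mem` — hence a prime ideal containing `p` is `𝔭 = (p, ω − k)` or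
  `𝔭' = (p, ω − (t − k))`, and (`exists_eq_pow_mul_pow_of_absNorm_eq`) every ideal of norm `p^e`
  is `𝔭^i 𝔭'^j` with `i + j = e`;
* the split / ramified / inert trichotomy built on this is in `IdealsOfPrimePowerNormCases.lean`.

## References

* D. A. Cox, *Primes of the form x² + ny²*, 2nd ed. (2013), §5.B Prop. 5.16, §7.B Thm. 7.7 [Cox2013].
* H. Cohen, *A Course in Computational Algebraic Number Theory*, GTM 138 (1993), §5.2 [Cohen1993].
-/

noncomputable section

open Module NumberField Ideal

namespace Literature.NumberTheory.QuadraticFields.Quadratic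

variable {K : Type*} [Field K] [NumberField K] (b : Basis (Fin 2) ℤ (𝓞 K)) (hb : b 0 = 1)
  {t m : ℤ} (hω : b 1 * b 1 = (m : 𝓞 K) + (t : 𝓞 K) * b 1)

/-! ### Norms of principal and Hermite-normal-form ideals -/

include b in
/-- `N((n)) = n²` for an integer `n` in a quadratic ring of integers (`N_{K/ℚ}(n) = n^{[K:ℚ]}`;
the integral basis `b` witnesses `[K:ℚ] = 2`). [folklore] -/
theorem absNorm_span_singleton_intCast (n : ℤ) :
    absNorm (span {(n : 𝓞 K)}) = n.natAbs ^ 2 := by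
  have hr : finrank ℤ (𝓞 K) = 2 := by simpa using finrank_eq_card_basis b
  rw [absNorm_span_singleton, ← eq_intCast (algebraMap ℤ (𝓞 K)) n, Algebra.norm_algebraMap, hr,
    Int.natAbs_pow]

include b in
/-- `N((p)^j) = p^{2j}` for a natural number `p` (Mathlib's `absNorm_span_natCast` with
`rank_ℤ 𝓞 K = 2` read off the basis `b`). [folklore] -/
theorem absNorm_span_singleton_natCast_pow (p j : ℕ) :
    absNorm (span {(p : 𝓞 K)} ^ j) = p ^ (2 * j) := by
  have hr : finrank ℤ (𝓞 K) = 2 := by simpa using finrank_eq_card_basis b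
  rw [map_pow, absNorm_span_natCast, hr, ← pow_mul]

include hb hω in
/-- `N((g)(A, ω − k)) = g² A` when `AC = k² − tk − m`. [cite: Cox2013, §7.B Thm. 7.7] -/
theorem absNorm_span_singleton_mul_span_pair {g A k C : ℤ} (hn : A * C = k ^ 2 - t * k - m) :
    absNorm (span {(g : 𝓞 K)} * span {(A : 𝓞 K), b 1 - k}) = g.natAbs ^ 2 * A.natAbs := by
  rw [map_mul, absNorm_span_singleton_intCast b g, absNorm_span_pair_eq b hb hω hn]

include hb hω in
/-- **An ideal of prime norm `p` is `(p, ω − k)` with `p ∣ k² − tk − m`** (its Hermite normal form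
`(g)(A, ω − k)` has `g²A = p`, so `g = 1`, `A = p`). [cite: Cox2013, §7.B Thm. 7.7] -/
theorem exists_eq_span_pair_of_absNorm_eq_prime {p : ℕ} (hp : p.Prime) {I : Ideal (𝓞 K)}
    (hI : absNorm I = p) :
    ∃ k C : ℤ, (p : ℤ) * C = k ^ 2 - t * k - m ∧ I = span {((p : ℤ) : 𝓞 K), b 1 - k} := by
  have hI0 : I ≠ ⊥ := by
    rintro rfl
    rw [absNorm_bot] at hI
    exact hp.ne_zero hI.symm
  obtain ⟨g, A, k, C, hg, hA, hn, hIeq⟩ := exists_eq_span_singleton_mul_span_pair b hb hω hI0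
  have hnorm := absNorm_span_singleton_mul_span_pair b hb hω (g := g) hn
  rw [← hIeq, hI] at hnorm
  obtain ⟨g', rfl⟩ := Int.eq_ofNat_of_zero_le hg.le
  obtain ⟨A', rfl⟩ := Int.eq_ofNat_of_zero_le hA.le
  simp only [Int.natAbs_natCast] at hnorm
  have hA0 : 0 < A' := by exact_mod_cast hA
  -- `p = g'^2 A'` with `p` prime forces `g' = 1`, `A' = p`
  have hg1 : g' = 1 := by
    refine (hp.eq_one_or_self_of_dvd g' ⟨g' * A', by rw [hnorm]; ring⟩).resolve_right fun h => ?_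
    rw [h] at hnorm
    have h1 : p * 1 < p * (p * A') :=
      Nat.mul_lt_mul_of_pos_left (by nlinarith [hp.one_lt]) hp.pos
    nlinarith
  rw [hg1] at hnorm
  have hAp : A' = p := by simpa using hnorm.symm
  subst hAp
  refine ⟨k, C, hn, ?_⟩
  rw [hIeq, hg1]
  simp

/-! ### An ideal times its conjugate -/

omit [NumberField K] in
include hω in
/-- `(ω − k)(ω − (t − k)) = −(k² − tk − m)` (the norm of `ω − k`, up to sign: `ω̄ = t − ω`).
[folklore] -/
theorem sub_mul_sub_conj_eq (k : ℤ) :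
    (b 1 - k) * (b 1 - ((t - k : ℤ) : 𝓞 K)) = -((k ^ 2 - t * k - m : ℤ) : 𝓞 K) := by
  push_cast
  linear_combination hω

include hω in
/-- **An ideal times its conjugate is its norm**: for `AC = k² − tk − m` with `gcd(A, 2k − t, C) = 1`
(a primitive form `(A, 2k − t, C)`), `(A, ω − k) · (A, ω − (t − k)) = (A)`. The product is
`A · (A, ω − k, ω − (t − k), C)` and the second factor contains `A`, `2k − t`, `C`, hence `1`.
[cite: Cox2013, §7.B Thm. 7.7] -/
theorem span_pair_mul_span_pair_conj {A k C : ℤ} (hn : A * C = k ^ 2 - t * k - m)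
    (hprim : ∀ d : ℤ, d ∣ A → d ∣ 2 * k - t → d ∣ C → IsUnit d) :
    span {(A : 𝓞 K), b 1 - k} * span {(A : 𝓞 K), b 1 - ((t - k : ℤ) : 𝓞 K)} =
      span {(A : 𝓞 K)} := by
  have hconj := sub_mul_sub_conj_eq b hω k
  have hAC : ((k ^ 2 - t * k - m : ℤ) : 𝓞 K) = (A : 𝓞 K) * C := by
    rw [← hn]; push_cast; ring
  rw [hAC] at hconj
  rw [span_pair_mul_span_pair]
  refine le_antisymm ?_ ?_
  · rw [span_le]
    rintro x hx
    simp only [Set.mem_insert_iff, Set.mem_singleton_iff] at hx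
    rw [SetLike.mem_coe, mem_span_singleton']
    rcases hx with rfl | rfl | rfl | rfl
    · exact ⟨(A : 𝓞 K), rfl⟩
    · exact ⟨b 1 - ((t - k : ℤ) : 𝓞 K), by ring⟩
    · exact ⟨b 1 - k, by ring⟩
    · exact ⟨-(C : 𝓞 K), by rw [hconj]; ring⟩
  · -- Bezout: `xA + y(2k − t) + zC = 1`
    have hg : Int.gcd (Int.gcd A (2 * k - t)) C = 1 := by
      have h1 := hprim (Int.gcd (Int.gcd A (2 * k - t)) C)
        ((Int.gcd_dvd_left _ _).trans (Int.gcd_dvd_left _ _))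
        ((Int.gcd_dvd_left _ _).trans (Int.gcd_dvd_right _ _)) (Int.gcd_dvd_right _ _)
      have := Int.isUnit_iff_natAbs_eq.1 h1
      rwa [Int.natAbs_natCast] at this
    set I : Ideal (𝓞 K) := span {(A : 𝓞 K) * A, (A : 𝓞 K) * (b 1 - ((t - k : ℤ) : 𝓞 K)),
      (b 1 - k) * A, (b 1 - k) * (b 1 - ((t - k : ℤ) : 𝓞 K))} with hI
    have h1 : (A : 𝓞 K) * A ∈ I := subset_span (by simp)
    have h2 : (A : 𝓞 K) * (b 1 - ((t - k : ℤ) : 𝓞 K)) ∈ I := subset_span (by simp)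
    have h3 : (b 1 - k) * (A : 𝓞 K) ∈ I := subset_span (by simp)
    have h4 : (b 1 - k) * (b 1 - ((t - k : ℤ) : 𝓞 K)) ∈ I := subset_span (by simp)
    -- `A (2k − t) = (ω − k)A − A(ω − (t − k))… ∈ I` and `A C = −(ω − k)(ω − (t − k)) ∈ I`
    have hAB : (A : 𝓞 K) * ((2 * k - t : ℤ) : 𝓞 K) ∈ I := by
      have : (A : 𝓞 K) * ((2 * k - t : ℤ) : 𝓞 K) =
          (A : 𝓞 K) * (b 1 - ((t - k : ℤ) : 𝓞 K)) - (b 1 - k) * A := by push_cast; ring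
      rw [this]
      exact I.sub_mem h2 h3
    have hAC' : (A : 𝓞 K) * C ∈ I := by
      have : (A : 𝓞 K) * C = -((b 1 - k) * (b 1 - ((t - k : ℤ) : 𝓞 K))) := by
        rw [hconj]; ring
      rw [this]
      exact I.neg_mem h4
    have hmem : (A : 𝓞 K) ∈ I := by
      have e1 := Int.gcd_eq_gcd_ab (Int.gcd A (2 * k - t) : ℤ) C
      rw [hg, Int.gcd_eq_gcd_ab A (2 * k - t)] at e1
      set x := A.gcdA (2 * k - t)
      set y := A.gcdB (2 * k - t)
      set u := ((A * x + (2 * k - t) * y : ℤ)).gcdA C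
      set v := ((A * x + (2 * k - t) * y : ℤ)).gcdB C
      have e4 : (A : 𝓞 K) = (A : 𝓞 K) * A * ((x * u : ℤ) : 𝓞 K) +
          (A : 𝓞 K) * ((2 * k - t : ℤ) : 𝓞 K) * ((y * u : ℤ) : 𝓞 K) +
            (A : 𝓞 K) * C * ((v : ℤ) : 𝓞 K) := by
        have := congrArg (fun z : ℤ => ((A * z : ℤ) : 𝓞 K)) e1
        push_cast at this ⊢
        linear_combination this
      rw [e4]
      exact I.add_mem (I.add_mem (I.mul_mem_right _ h1) (I.mul_mem_right _ hAB))
        (I.mul_mem_right _ hAC')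
    exact (span_singleton_le_iff_mem _).2 hmem

/-! ### Prime ideals over `p` -/

omit [NumberField K] in
/-- An ideal of prime norm is maximal. [folklore] -/
theorem isMaximal_of_absNorm_eq_prime [NumberField K] {I : Ideal (𝓞 K)} {p : ℕ} (hp : p.Prime)
    (hI : absNorm I = p) : I.IsMaximal := by
  have hprime : I.IsPrime := isPrime_of_irreducible_absNorm (hI ▸ hp)
  have h0 : I ≠ ⊥ := by
    rintro rfl
    rw [absNorm_bot] at hI
    exact hp.ne_zero hI.symm
  exact hprime.isMaximal h0

include hb hω in
/-- `N(p, ω − k) = p` when `pC = k² − tk − m`. [cite: Cox2013, §7.B Thm. 7.7] -/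
theorem absNorm_span_pair_prime {p : ℕ} {k C : ℤ} (hn : (p : ℤ) * C = k ^ 2 - t * k - m) :
    absNorm (span {((p : ℤ) : 𝓞 K), b 1 - k}) = p := by
  rw [absNorm_span_pair_eq b hb hω hn, Int.natAbs_natCast]

/-- The conjugate data: `pC = (t − k)² − t(t − k) − m` as well. [folklore] -/
theorem norm_eq_conj {A k C t m : ℤ} (hn : A * C = k ^ 2 - t * k - m) :
    A * C = (t - k) ^ 2 - t * (t - k) - m := by
  linear_combination hn

include hb hω in
/-- **The prime ideals containing `p` are `𝔭 = (p, ω − k)` and `𝔭' = (p, ω − (t − k))`** when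
`pC = k² − tk − m` with `gcd(p, 2k − t, C) = 1`: a prime `P ∋ p` contains `(p) = 𝔭𝔭'`, hence one
of the maximal ideals `𝔭`, `𝔭'`. [cite: Cox2013, §5.B Prop. 5.16] -/
theorem eq_or_eq_of_isPrime_of_natCast_mem {p : ℕ} (hp : p.Prime) {k C : ℤ}
    (hn : (p : ℤ) * C = k ^ 2 - t * k - m)
    (hprim : ∀ d : ℤ, d ∣ (p : ℤ) → d ∣ 2 * k - t → d ∣ C → IsUnit d)
    {P : Ideal (𝓞 K)} (hP : P.IsPrime) (hpP : (p : 𝓞 K) ∈ P) :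
    P = span {((p : ℤ) : 𝓞 K), b 1 - k} ∨ P = span {((p : ℤ) : 𝓞 K), b 1 - ((t - k : ℤ) : 𝓞 K)} := by
  have hprod := span_pair_mul_span_pair_conj b hω hn hprim
  have hle : span {((p : ℤ) : 𝓞 K), b 1 - k} * span {((p : ℤ) : 𝓞 K), b 1 - ((t - k : ℤ) : 𝓞 K)} ≤ P := by
    rw [hprod, span_singleton_le_iff_mem, Int.cast_natCast]
    exact hpP
  have hmax := isMaximal_of_absNorm_eq_prime hp (absNorm_span_pair_prime b hb hω hn)
  have hmax' := isMaximal_of_absNorm_eq_prime hp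
    (absNorm_span_pair_prime b hb hω (norm_eq_conj hn) (p := p))
  rcases hP.mul_le.1 hle with h | h
  · exact Or.inl (hmax.eq_of_le hP.ne_top h).symm
  · exact Or.inr (hmax'.eq_of_le hP.ne_top h).symm

include hb hω in
/-- **Every ideal of norm `p^e` is `𝔭^i 𝔭'^j` with `i + j = e`** (`𝔭 = (p, ω − k)`,
`𝔭' = (p, ω − (t − k))`, `pC = k² − tk − m`, `gcd(p, 2k − t, C) = 1`): a maximal ideal above an
ideal of norm `p^e`, `e ≥ 1`, contains `p`, so it is `𝔭` or `𝔭'` and divides the ideal; induct.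
[cite: Cox2013, §7.B Thm. 7.7] -/
theorem exists_eq_pow_mul_pow_of_absNorm_eq {p : ℕ} (hp : p.Prime) {k C : ℤ}
    (hn : (p : ℤ) * C = k ^ 2 - t * k - m)
    (hprim : ∀ d : ℤ, d ∣ (p : ℤ) → d ∣ 2 * k - t → d ∣ C → IsUnit d) {e : ℕ} {I : Ideal (𝓞 K)}
    (hI : absNorm I = p ^ e) :
    ∃ i j : ℕ, i + j = e ∧ I = span {((p : ℤ) : 𝓞 K), b 1 - k} ^ i *
      span {((p : ℤ) : 𝓞 K), b 1 - ((t - k : ℤ) : 𝓞 K)} ^ j := by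
  induction e generalizing I with
  | zero =>
    refine ⟨0, 0, rfl, ?_⟩
    rw [pow_zero] at hI
    rw [absNorm_eq_one_iff.1 hI, pow_zero, pow_zero, one_mul, one_eq_top]
  | succ e ih =>
    have hItop : I ≠ ⊤ := by
      rintro rfl
      rw [absNorm_top] at hI
      have : 1 < p ^ (e + 1) := Nat.one_lt_pow (Nat.succ_ne_zero e) hp.one_lt
      omega
    obtain ⟨P, hPmax, hIP⟩ := exists_le_maximal I hItop
    have hpP : (p : 𝓞 K) ∈ P := by
      have h1 : ((absNorm I : ℕ) : 𝓞 K) ∈ P := hIP (absNorm_mem I)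
      rw [hI, Nat.cast_pow] at h1
      exact hPmax.isPrime.mem_of_pow_mem _ h1
    obtain ⟨J, hJ⟩ := Ideal.dvd_iff_le.2 hIP
    have hJn : ∀ (hPn : absNorm P = p), absNorm J = p ^ e := fun hPn => by
      have h := congrArg absNorm hJ
      rw [map_mul, hI, hPn, pow_succ'] at h
      exact (Nat.eq_of_mul_eq_mul_left hp.pos h).symm
    rcases eq_or_eq_of_isPrime_of_natCast_mem b hb hω hp hn hprim hPmax.isPrime hpP with hP | hP
    · have hPn : absNorm P = p := hP ▸ absNorm_span_pair_prime b hb hω hn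
      obtain ⟨i, j, hij, hJeq⟩ := ih (hJn hPn)
      refine ⟨i + 1, j, by omega, ?_⟩
      rw [hJ, hJeq, hP]
      ring
    · have hPn : absNorm P = p := hP ▸ absNorm_span_pair_prime b hb hω (norm_eq_conj hn) (p := p)
      obtain ⟨i, j, hij, hJeq⟩ := ih (hJn hPn)
      refine ⟨i, j + 1, by omega, ?_⟩
      rw [hJ, hJeq, hP]
      ring

include hb hω in
/-- `N(𝔭^i 𝔭'^j) = p^{i+j}`. [folklore] -/
theorem absNorm_pow_mul_pow {p : ℕ} {k C : ℤ} (hn : (p : ℤ) * C = k ^ 2 - t * k - m) (i j : ℕ) :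
    absNorm (span {((p : ℤ) : 𝓞 K), b 1 - k} ^ i *
      span {((p : ℤ) : 𝓞 K), b 1 - ((t - k : ℤ) : 𝓞 K)} ^ j) = p ^ (i + j) := by
  rw [map_mul, map_pow, map_pow, absNorm_span_pair_prime b hb hω hn,
    absNorm_span_pair_prime b hb hω (norm_eq_conj hn) (p := p), pow_add]

end Literature.NumberTheory.QuadraticFields.Quadratic

end
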